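import Mathlib
import HarnessLib

/-!
# PHASE RIGIDITY of the coupled parity form: the geometric-mean law, abstract kernel
# (pub-rhpf FAKE SEAT 4, gen 3; helper for item stmt-RiemannHypothesis-19953)

**mechanism/rigidity campaign; no RH claims.**  Everything here is RH-free, sorry-free elementary algebra of a
real quadratic form on a product space.  Companion text and DATA: `run/shared/lean/pub/pub-rhpf/FAKES.md §4.9`
(THEOREM F4-C).

## The structure

A completely multiplicative unimodular ("Steinhaus") twist `f` of a prime table makes the windowed Weil form a
HERMITIAN form on complex test functions `F = f_e + i f_o` (`f_e` real even, `f_o` real odd).  In real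
coordinates it is the COUPLED PARITY FORM
`S(u, v) = A(u, u) + 2·X(u, v) + D(v, v)`,
with `A` = even block (weights `Λ Re f · n^{-1/2}`), `D` = odd block, and the CROSS PAIRING
`X(u, v) = -2 Σ Λ(n) Im f(n) n^{-1/2} K_{u,v}(log n)`, `K_{u,v}(y) = ∫ f_e(x + y) f_o(x) dx` (odd in `y`; the
polar, archimedean and conductor terms do not see it).  For the one-prime rotation `f(p^k) = e^{ikφ}` the cross
pairing is `sin φ · X₁ + O(φ³)` and the blocks move by `O(φ²)`; the abstract object below is the family
`S_s = A + 2 s X + D` at COUPLING `s` (`CoupledForm.S`).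

## PROVED (for every `CoupledForm`, i.e. every pair of blocks and every cross pairing)

* `sq_le_mul_of_psdAt` (compression / Cauchy–Schwarz): if `S_s ≥ 0` then `(s · X(u,v))² ≤ A(u,u) · D(v,v)`
  for all `u, v`;
* `abs_coupling_le_of_psdAt` (GEOMETRIC-MEAN LAW, upper half of THEOREM F4-C): if `S_s ≥ 0` and
  `X(u,v) ≠ 0` then `|s| ≤ √(A(u,u)·D(v,v)) / |X(u,v)|` — with `u, v` the two bottom eigenvectors this is
  `φ_lin ≤ √(ε₁^even ε₁^odd) / |c_p|`;
* `S_witness_neg` (the CANONICAL KILLING VECTOR used by the Arb certificates (U2) of §4.9): if `0 < A(u,u)` and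
  `A(u,u)·D(v,v) < (s·X(u,v))²` then `S_s((s X(u,v)) • u, (−A(u,u)) • v) = A(u,u)·(A(u,u) D(v,v) − (s X(u,v))²) < 0`;
* `psdAt_neg_iff`, `psdAt_of_abs_le` (EVENNESS and MONOTONICITY in the coupling): `S_{s₀} ≥ 0 → |s| ≤ |s₀| →
  S_s ≥ 0` — the set of admissible couplings is a symmetric interval; this is what lets ONE positive-definiteness
  certificate at `φ⁻` cover all `0 ≤ φ ≤ φ⁻` in §4.9.

The lower half of THEOREM F4-C (`φ_lin ≥ √(ε_e ε_o)/(|c|√(1+ρ))`, a secular-equation bound using the second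
eigenvalues) is proved in the companion text; its numerical content is carried by the Arb certificates.

## Why the cell cares (DATA labels; FAKES.md §4.9)

For ζ's table the law pins the phase slack of every prime inside the window to the geometric mean of the two
parity ground levels.  DATA (two float engines — this seat's closed-form cross block and pub-weilobs engB's
`cross_corr`/`coupling_norm` — agreeing to > 30 digits, plus Arb certificates; table in FAKES.md §4.9):
at `(a, N, p) = (0.75, 40, 2)`: `ε₁^even = 4.60e-15`, `ε₁^odd = 3.73e-12`, `|c_2| = 0.1063`, `ρ = 6.5e-4`,
`φ_lin = 1.2312e-12 = 0.99991 · φ_GM`; the killing direction is the complex combination `u_e + i·t·v_o` of the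
two (individually nodal or not) parity ground states, `|F|² = f_e² + t² f_o²` — in contrast with the REAL
down-cone (THEOREM F4-A, `PfPersistenceDownConeNodal`), where failing directions are forced to be nodal.
No statement about `ζ` beyond DATA is made here.

References: I. Schur, J. reine angew. Math. 147 (1917) 205–232 (Schur complement); A. Weil, Comm. Sém. Math.
Univ. Lund (1952) 252–265 (explicit formula as a Hermitian form); A. Connes, C. Consani, arXiv:2106.01715 (window forms).
-/

namespace Summit.RiemannHypothesis.RiemannHypothesis.Theorems.PfPersistencePhaseRigidity

/-- A coupled parity form: even block `A`, odd block `D`, cross pairing `X` (all real bilinear). -/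
structure CoupledForm (E O : Type*) [AddCommGroup E] [Module ℝ E] [AddCommGroup O] [Module ℝ O] where
  /-- even block -/
  A : E →ₗ[ℝ] E →ₗ[ℝ] ℝ
  /-- odd block -/
  D : O →ₗ[ℝ] O →ₗ[ℝ] ℝ
  /-- cross pairing (even × odd) -/
  X : E →ₗ[ℝ] O →ₗ[ℝ] ℝ

namespace CoupledForm

variable {E O : Type*} [AddCommGroup E] [Module ℝ E] [AddCommGroup O] [Module ℝ O]
variable (C : CoupledForm E O)

/-- The quadratic form of the coupled block form at coupling `s`, evaluated at `z = (u, v)`. -/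
def S (s : ℝ) (u : E) (v : O) : ℝ := C.A u u + 2 * s * C.X u v + C.D v v

/-- Positive semidefiniteness at coupling `s`. -/
def PSDAt (s : ℝ) : Prop := ∀ (u : E) (v : O), 0 ≤ C.S s u v

/-- Scaling the odd component: the form value is a quadratic polynomial in the scale. -/
theorem S_smul_right (s t : ℝ) (u : E) (v : O) :
    C.S s u (t • v) = C.D v v * (t * t) + (2 * s * C.X u v) * t + C.A u u := by
  simp only [S, map_smul, LinearMap.smul_apply, smul_eq_mul]
  ring

/-- Scaling both components. -/
theorem S_smul_smul (s a b : ℝ) (u : E) (v : O) :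
    C.S s (a • u) (b • v) = a ^ 2 * C.A u u + 2 * s * a * b * C.X u v + b ^ 2 * C.D v v := by
  simp only [S, map_smul, LinearMap.smul_apply, smul_eq_mul]
  ring

/-- Conjugating the odd component flips the sign of the coupling. -/
theorem S_neg_right (s : ℝ) (u : E) (v : O) : C.S s u (-v) = C.S (-s) u v := by
  simp only [S, map_neg, LinearMap.neg_apply]
  ring

/-- COMPRESSION (Cauchy–Schwarz for the coupled form): PSD at coupling `s` forces
`(s·X(u,v))² ≤ A(u,u)·D(v,v)` for every pair of test vectors. -/
theorem sq_le_mul_of_psdAt {s : ℝ} (h : C.PSDAt s) (u : E) (v : O) :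
    (s * C.X u v) ^ 2 ≤ C.A u u * C.D v v := by
  have hq : ∀ t : ℝ, 0 ≤ C.D v v * (t * t) + (2 * s * C.X u v) * t + C.A u u := by
    intro t
    have := h u (t • v)
    rwa [C.S_smul_right] at this
  have hd := discrim_le_zero hq
  unfold discrim at hd
  nlinarith [hd]

/-- GEOMETRIC-MEAN LAW (upper half of THEOREM F4-C): PSD at coupling `s` and a non-zero cross pairing of the
two test vectors force `|s| ≤ √(A(u,u) D(v,v)) / |X(u,v)|`. -/
theorem abs_coupling_le_of_psdAt {s : ℝ} (h : C.PSDAt s) {u : E} {v : O} (hX : C.X u v ≠ 0) :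
    |s| ≤ Real.sqrt (C.A u u * C.D v v) / |C.X u v| := by
  have h1 : |s * C.X u v| ≤ Real.sqrt (C.A u u * C.D v v) := Real.abs_le_sqrt (C.sq_le_mul_of_psdAt h u v)
  rw [abs_mul] at h1
  have hpos : 0 < |C.X u v| := abs_pos.mpr hX
  rw [le_div_iff₀ hpos]
  exact h1

/-- The CANONICAL KILLING VECTOR: if `0 < A(u,u)` and the geometric-mean inequality fails at coupling `s`, the
explicit vector `((s X(u,v)) • u, (−A(u,u)) • v)` has negative form value
`A(u,u) · (A(u,u) D(v,v) − (s X(u,v))²)`. -/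
theorem S_witness_eq (s : ℝ) (u : E) (v : O) :
    C.S s ((s * C.X u v) • u) ((-C.A u u) • v) = C.A u u * (C.A u u * C.D v v - (s * C.X u v) ^ 2) := by
  rw [C.S_smul_smul]
  ring

/-- The canonical killing vector has NEGATIVE form value as soon as `A(u,u) > 0` and
`A(u,u) D(v,v) < (s X(u,v))²` (this is the vector of the Arb certificates (U2) in FAKES §4.9). -/
theorem S_witness_neg {s : ℝ} {u : E} {v : O} (hA : 0 < C.A u u)
    (hgm : C.A u u * C.D v v < (s * C.X u v) ^ 2) :
    C.S s ((s * C.X u v) • u) ((-C.A u u) • v) < 0 := by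
  rw [C.S_witness_eq]
  exact mul_neg_of_pos_of_neg hA (by linarith)

/-- Contrapositive form: beyond the geometric-mean radius the coupled form is NOT positive semidefinite. -/
theorem not_psdAt_of_gm_lt {s : ℝ} {u : E} {v : O}
    (hgm : C.A u u * C.D v v < (s * C.X u v) ^ 2) : ¬ C.PSDAt s := by
  intro h
  exact absurd (C.sq_le_mul_of_psdAt h u v) (not_le.mpr hgm)

/-- EVENNESS in the coupling: `S_{-s} ≥ 0 ↔ S_s ≥ 0` (conjugate the odd component). -/
theorem psdAt_neg_iff (s : ℝ) : C.PSDAt (-s) ↔ C.PSDAt s := by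
  constructor
  · intro h u v
    have := h u (-v)
    rwa [C.S_neg_right, neg_neg] at this
  · intro h u v
    have := h u (-v)
    rwa [C.S_neg_right] at this

/-- MONOTONICITY in the coupling: the admissible couplings form a symmetric interval around `0`. -/
theorem psdAt_of_abs_le {s₀ s : ℝ} (h : C.PSDAt s₀) (hs : |s| ≤ |s₀|) : C.PSDAt s := by
  intro u v
  have hp : 0 ≤ C.S |s₀| u v := by
    rcases abs_choice s₀ with h0 | h0 <;> rw [h0]
    · exact h u v
    · exact (C.psdAt_neg_iff s₀).mpr h u v
  have hm : 0 ≤ C.S (-|s₀|) u v := by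
    rcases abs_choice s₀ with h0 | h0 <;> rw [h0]
    · exact (C.psdAt_neg_iff s₀).mpr h u v
    · rw [neg_neg]; exact h u v
  by_cases h00 : s₀ = 0
  · have : s = 0 := by simpa [h00] using hs
    subst this
    have := h u v
    simp only [S] at this ⊢
    simpa [h00] using this
  · have ha : 0 < |s₀| := abs_pos.mpr h00
    -- s = λ |s₀| + (1 - λ) (-|s₀|) with λ = (s + |s₀|) / (2 |s₀|) ∈ [0, 1]; S is affine in the coupling
    set l : ℝ := (s + |s₀|) / (2 * |s₀|) with hl
    have hl0 : 0 ≤ l := by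
      rw [hl]; apply div_nonneg _ (by positivity); linarith [neg_abs_le s, abs_le.mp hs]
    have hl1 : l ≤ 1 := by
      rw [hl, div_le_one (by positivity)]; linarith [le_abs_self s, abs_le.mp hs]
    have hs_eq : s = l * |s₀| + (1 - l) * (-|s₀|) := by
      rw [hl]; field_simp; ring
    have key : C.S s u v = l * C.S |s₀| u v + (1 - l) * C.S (-|s₀|) u v := by
      simp only [S]; rw [hs_eq]; ring
    rw [key]
    exact add_nonneg (mul_nonneg hl0 hp) (mul_nonneg (by linarith) hm)

/-- The admissible PHASE RADIUS of a coupled form along a pair `(u, v)` with positive even energy: every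
coupling at which the form is PSD lies in the closed ball of radius `√(A(u,u) D(v,v)) / |X(u,v)|`, and the
explicit canonical vector witnesses failure beyond it (summary of the two halves used in FAKES §4.9). -/
theorem phase_radius {s : ℝ} {u : E} {v : O} (hA : 0 < C.A u u) (hX : C.X u v ≠ 0) :
    (C.PSDAt s → |s| ≤ Real.sqrt (C.A u u * C.D v v) / |C.X u v|) ∧
    (Real.sqrt (C.A u u * C.D v v) / |C.X u v| < |s| →
      C.S s ((s * C.X u v) • u) ((-C.A u u) • v) < 0) := by
  refine ⟨fun h => C.abs_coupling_le_of_psdAt h hX, fun hlt => C.S_witness_neg hA ?_⟩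
  have hpos : 0 < |C.X u v| := abs_pos.mpr hX
  rw [div_lt_iff₀ hpos, ← abs_mul] at hlt
  by_cases hprod : 0 ≤ C.A u u * C.D v v
  · have h2 : Real.sqrt (C.A u u * C.D v v) ^ 2 = C.A u u * C.D v v := Real.sq_sqrt hprod
    have h3 : Real.sqrt (C.A u u * C.D v v) ^ 2 < |s * C.X u v| ^ 2 := by
      have h0 : 0 ≤ Real.sqrt (C.A u u * C.D v v) := Real.sqrt_nonneg _
      nlinarith [hlt, h0]
    rw [h2, sq_abs] at h3
    exact h3
  · push Not at hprod
    have : 0 < (s * C.X u v) ^ 2 := by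
      have hne : s * C.X u v ≠ 0 := by
        intro h0; rw [h0, abs_zero] at hlt; exact absurd hlt (not_lt.mpr (Real.sqrt_nonneg _))
      positivity
    linarith

end CoupledForm

end Summit.RiemannHypothesis.RiemannHypothesis.Theorems.PfPersistencePhaseRigidity
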